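import Mathlib
import Literature.NumberTheory.Irrationality.Brown2016.DinnerParties
import Summits.KontsevichZagierPeriods.Zeta5Search.Families.CellularIntegral
import HarnessLib

/-!
# ζ(5) search — Families: atlas of the seventeen `N = 8` generalised cellular families, part C: `₈π₁₀, ₈π₁₀^∨, ₈π₂, ₈π₃, ₈π₆` (`Brown2016.reps8[12..16]`)

HONEST FRAMING: systematic search; no irrationality claim unless certified.

Cell `pub-zeta5`, seat P2 — the `fam-brown8` entry point ("the 16 non-BZ convergent `N = 8` dinner-party configurations
with GENERAL exponents").  For each convergent configuration `σ` of [Brown2016, App. 2 §10.1.4] (the list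
`Brown2016.reps8`, convergence and pairwise inequivalence kernel-checked there) this file gives, as an instance of
`Families/CellularIntegral.lean` [Brown2016, §5.1–5.2]:
* `p8_k : Fin 8 → Fin 8` — the seating plan read 0-based (`= ofSeating …`, injective, `= reps8[i]`: `p8_k_spec`);
* `p8_kDen a b : Fin 8 → ℤ` — the eight denominator exponents `b_{σ_j σ_{j+1}}` by position, in the UNIFORM parameters
  `a i = a_{i+1,i+2}` (numerator exponents on the edges of `δ⁰`, `a : Fin 8 → ℤ`) and `b` = the exponent of the last edge
  `(σ₈, σ₁)` of `σδ⁰`, the other seven solved from Brown's homogeneity equations (5.2);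
* `homogeneous_p8_k_iff` — `Homogeneous` holds exactly on Brown's lattice `H_σ` (5.5), written out;
* `brownConvergent_p8_k_iff` — on `H_σ`, Brown's convergence condition (`BrownConvergent`: the `8 × 5` chord valuations of
  §2.4/§3.4) is EQUIVALENT to an explicit irredundant system of linear inequalities (typically `a_i ≥ 0` plus 4–6 mixed
  hyperplanes).  The inequality systems were proposed by exact rational LP (HOME `code/p2/cellular_atlas.py`,
  `qsimplex.py`, `gen_atlas_lean.py`); every equivalence is kernel-checked here (`omega`), so the Python is not trusted.
The integrand of family `k` is `integrand p8_k a (p8_kDen a b)` (explicit rational function and positivity by the recipe /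
lemmas of `Families/CellularIntegral.lean`); which periods it produces is NOT asserted (Brown App. 2 §10.2.4 records the
weight-`≤ 5` content at basic exponents; the designers compute the general case).
NOTE on `₈π₆ = (8,3,6,1,4,7,2,5)`: Brown's lattice condition (5.5) is EMPTY for this configuration (the alternating sum
vanishes identically: consecutive vertices of `δ⁰` sit at positions of opposite parity in `σδ⁰`), so its generalised family
has `9 = n + 1` free exponents (`homogeneous_p8_6`, unconditional) — one more than the generic `n` of [Brown2016, §5.2].
-/

noncomputable section

open MeasureTheory Finset Set

namespace Summit.KontsevichZagierPeriods.Zeta5Search.Families.Cellular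

open Literature.NumberTheory.Irrationality

/-! ### `₈π₁₀ = (8,2,5,7,3,6,1,4)` -/

/-- `₈π₁₀ = (8,2,5,7,3,6,1,4)` [Brown2016, App. 2 §10.1.4] as a map `Fin 8 → Fin 8` (0-based values). -/
def p8_10 : Fin 8 → Fin 8 := ![7, 1, 4, 6, 2, 5, 0, 3]

/-- `p8_10` is the printed plan `(8,2,5,7,3,6,1,4)` read 0-based (`ofSeating`), and is injective. -/
theorem p8_10_spec : p8_10 = ofSeating (ℓ := 5) [8, 2, 5, 7, 3, 6, 1, 4] ∧ Function.Injective p8_10 ∧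
    Brown2016.reps8[12]? = some [8, 2, 5, 7, 3, 6, 1, 4] := by
  refine ⟨by decide, by decide, rfl⟩

/-- Denominator exponents of the generalised `₈π₁₀` family, by position on `σδ⁰`
(`b(8,2), b(2,5), b(5,7), b(7,3), b(3,6), b(6,1), b(1,4), b(4,8)`), in the parameters
`a i = a_{i+1,i+2}` (`a : Fin 8 → ℤ`, 0-based; indices mod 8) and the free exponent `b = b(4,8)`, the others
solved from Brown's homogeneity equations [Brown2016, §5.1 (5.2), §5.2]. -/
def p8_10Den (a : Fin 8 → ℤ) (b : ℤ) : Fin 8 → ℤ :=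
  ![a 6 + a 7 - b, a 0 + a 1 - a 6 - a 7 + b, -a 0 - a 1 + a 3 + a 4 + a 6 + a 7 - b,
    a 0 + a 1 - a 3 - a 4 + a 5 - a 7 + b, -a 0 + a 2 + a 3 + a 4 - a 5 + a 7 - b,
    a 0 - a 2 - a 3 + 2 * a 5 - a 7 + b, a 2 + a 3 - 2 * a 5 + 2 * a 7 - b, b]

/-- Homogeneity of the generalised `₈π₁₀` family holds exactly on Brown's lattice `H_σ` [Brown2016, §5.2 (5.5)]:
`a 7 = a 5`. -/
theorem homogeneous_p8_10_iff (a : Fin 8 → ℤ) (b : ℤ) :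
    Homogeneous p8_10 a (p8_10Den a b) ↔ a 7 = a 5 := by
  unfold Homogeneous
  dsimp only [Nat.reduceAdd]
  have e : (-1 : Fin 8) = 7 := by decide
  constructor
  · intro h
    have h' := h 7
    simp [p8_10, p8_10Den] at h'
    linarith
  · intro h i
    fin_cases i <;> simp [p8_10, p8_10Den, e] <;> linarith

/-- The region of convergence of the generalised `₈π₁₀` family on `H_σ`: Brown's chord condition (all
`8 × 5` valuations; 18 distinct forms modulo `H_σ`, of which the 10 below are irredundant over `ℝ` —
exact LP, HOME `code/p2/cellular_atlas.py`; the equivalence itself is kernel-checked). [Brown2016, §2.4 (2.3), §5.2] -/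
theorem brownConvergent_p8_10_iff (a : Fin 8 → ℤ) (b : ℤ) (hH : a 7 = a 5) :
    BrownConvergent p8_10 a (p8_10Den a b) ↔
      0 ≤ a 0 ∧
      0 ≤ a 1 ∧
      0 ≤ a 2 ∧
      0 ≤ a 3 ∧
      0 ≤ a 4 ∧
      0 ≤ a 6 ∧
      0 ≤ a 7 ∧
      0 ≤ a 0 - a 6 + b ∧
      0 ≤ a 0 + a 1 - a 3 - a 6 + b ∧
      0 ≤ -a 0 + a 2 + a 3 + a 6 + a 7 - b + 1 := by
  unfold BrownConvergent twoOrd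
  dsimp only [Nat.reduceAdd]
  simp only [forall_fin8, forall_fin5, Fin.sum_univ_eight]
  simp [sameSide, p8_10, p8_10Den]
  constructor <;> intro h <;> and_intros <;> omega

/-! ### `₈π₁₀^∨ = (8,2,5,7,4,1,6,3)` -/

/-- `₈π₁₀^∨ = (8,2,5,7,4,1,6,3)` [Brown2016, App. 2 §10.1.4] as a map `Fin 8 → Fin 8` (0-based values). -/
def p8_10v : Fin 8 → Fin 8 := ![7, 1, 4, 6, 3, 0, 5, 2]

/-- `p8_10v` is the printed plan `(8,2,5,7,4,1,6,3)` read 0-based (`ofSeating`), and is injective. -/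
theorem p8_10v_spec : p8_10v = ofSeating (ℓ := 5) [8, 2, 5, 7, 4, 1, 6, 3] ∧ Function.Injective p8_10v ∧
    Brown2016.reps8[13]? = some [8, 2, 5, 7, 4, 1, 6, 3] := by
  refine ⟨by decide, by decide, rfl⟩

/-- Denominator exponents of the generalised `₈π₁₀^∨` family, by position on `σδ⁰`
(`b(8,2), b(2,5), b(5,7), b(7,4), b(4,1), b(1,6), b(6,3), b(3,8)`), in the parameters
`a i = a_{i+1,i+2}` (`a : Fin 8 → ℤ`, 0-based; indices mod 8) and the free exponent `b = b(3,8)`, the others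
solved from Brown's homogeneity equations [Brown2016, §5.1 (5.2), §5.2]. -/
def p8_10vDen (a : Fin 8 → ℤ) (b : ℤ) : Fin 8 → ℤ :=
  ![a 6 + a 7 - b, a 0 + a 1 - a 6 - a 7 + b, -a 0 - a 1 + a 3 + a 4 + a 6 + a 7 - b,
    a 0 + a 1 - a 3 - a 4 + a 5 - a 7 + b, -a 0 - a 1 + a 2 + 2 * a 3 + a 4 - a 5 + a 7 - b,
    2 * a 0 + a 1 - a 2 - 2 * a 3 - a 4 + a 5 + b, -2 * a 0 - a 1 + a 2 + 2 * a 3 + 2 * a 4 - b, b]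

/-- Homogeneity of the generalised `₈π₁₀^∨` family holds exactly on Brown's lattice `H_σ` [Brown2016, §5.2 (5.5)]:
`a 3 + a 4 = a 0 + a 1`. -/
theorem homogeneous_p8_10v_iff (a : Fin 8 → ℤ) (b : ℤ) :
    Homogeneous p8_10v a (p8_10vDen a b) ↔ a 3 + a 4 = a 0 + a 1 := by
  unfold Homogeneous
  dsimp only [Nat.reduceAdd]
  have e : (-1 : Fin 8) = 7 := by decide
  constructor
  · intro h
    have h' := h 7
    simp [p8_10v, p8_10vDen] at h'
    linarith
  · intro h i
    fin_cases i <;> simp [p8_10v, p8_10vDen, e] <;> linarith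

/-- The region of convergence of the generalised `₈π₁₀^∨` family on `H_σ`: Brown's chord condition (all
`8 × 5` valuations; 19 distinct forms modulo `H_σ`, of which the 12 below are irredundant over `ℝ` —
exact LP, HOME `code/p2/cellular_atlas.py`; the equivalence itself is kernel-checked). [Brown2016, §2.4 (2.3), §5.2] -/
theorem brownConvergent_p8_10v_iff (a : Fin 8 → ℤ) (b : ℤ) (hH : a 3 + a 4 = a 0 + a 1) :
    BrownConvergent p8_10v a (p8_10vDen a b) ↔
      0 ≤ a 0 ∧
      0 ≤ a 1 ∧
      0 ≤ a 2 ∧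
      0 ≤ a 3 ∧
      0 ≤ a 4 ∧
      0 ≤ a 5 ∧
      0 ≤ a 6 ∧
      0 ≤ a 7 ∧
      0 ≤ a 0 - a 6 + b ∧
      0 ≤ a 3 + a 4 - a 6 ∧
      0 ≤ a 4 + a 5 - a 6 - a 7 + b ∧
      0 ≤ -a 0 + a 2 + a 3 + a 6 + a 7 - b + 1 := by
  unfold BrownConvergent twoOrd
  dsimp only [Nat.reduceAdd]
  simp only [forall_fin8, forall_fin5, Fin.sum_univ_eight]
  simp [sameSide, p8_10v, p8_10vDen]
  constructor <;> intro h <;> and_intros <;> omega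

/-! ### `₈π₂ = (8,2,4,1,6,3,7,5)` -/

/-- `₈π₂ = (8,2,4,1,6,3,7,5)` [Brown2016, App. 2 §10.1.4] as a map `Fin 8 → Fin 8` (0-based values). -/
def p8_2 : Fin 8 → Fin 8 := ![7, 1, 3, 0, 5, 2, 6, 4]

/-- `p8_2` is the printed plan `(8,2,4,1,6,3,7,5)` read 0-based (`ofSeating`), and is injective. -/
theorem p8_2_spec : p8_2 = ofSeating (ℓ := 5) [8, 2, 4, 1, 6, 3, 7, 5] ∧ Function.Injective p8_2 ∧
    Brown2016.reps8[14]? = some [8, 2, 4, 1, 6, 3, 7, 5] := by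
  refine ⟨by decide, by decide, rfl⟩

/-- Denominator exponents of the generalised `₈π₂` family, by position on `σδ⁰`
(`b(8,2), b(2,4), b(4,1), b(1,6), b(6,3), b(3,7), b(7,5), b(5,8)`), in the parameters
`a i = a_{i+1,i+2}` (`a : Fin 8 → ℤ`, 0-based; indices mod 8) and the free exponent `b = b(5,8)`, the others
solved from Brown's homogeneity equations [Brown2016, §5.1 (5.2), §5.2]. -/
def p8_2Den (a : Fin 8 → ℤ) (b : ℤ) : Fin 8 → ℤ :=
  ![a 6 + a 7 - b, a 0 + a 1 - a 6 - a 7 + b, -a 0 - a 1 + a 2 + a 3 + a 6 + a 7 - b,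
    2 * a 0 + a 1 - a 2 - a 3 - a 6 + b, -2 * a 0 - a 1 + a 2 + a 3 + a 4 + a 5 + a 6 - b,
    2 * a 0 + 2 * a 1 - a 3 - a 4 - a 5 - a 6 + b, -2 * a 0 - 2 * a 1 + a 3 + a 4 + 2 * a 5 + 2 * a 6 - b, b]

/-- Homogeneity of the generalised `₈π₂` family holds exactly on Brown's lattice `H_σ` [Brown2016, §5.2 (5.5)]:
`a 5 + a 6 = a 0 + a 1`. -/
theorem homogeneous_p8_2_iff (a : Fin 8 → ℤ) (b : ℤ) :
    Homogeneous p8_2 a (p8_2Den a b) ↔ a 5 + a 6 = a 0 + a 1 := by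
  unfold Homogeneous
  dsimp only [Nat.reduceAdd]
  have e : (-1 : Fin 8) = 7 := by decide
  constructor
  · intro h
    have h' := h 7
    simp [p8_2, p8_2Den] at h'
    linarith
  · intro h i
    fin_cases i <;> simp [p8_2, p8_2Den, e] <;> linarith

/-- The region of convergence of the generalised `₈π₂` family on `H_σ`: Brown's chord condition (all
`8 × 5` valuations; 19 distinct forms modulo `H_σ`, of which the 12 below are irredundant over `ℝ` —
exact LP, HOME `code/p2/cellular_atlas.py`; the equivalence itself is kernel-checked). [Brown2016, §2.4 (2.3), §5.2] -/
theorem brownConvergent_p8_2_iff (a : Fin 8 → ℤ) (b : ℤ) (hH : a 5 + a 6 = a 0 + a 1) :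
    BrownConvergent p8_2 a (p8_2Den a b) ↔
      0 ≤ a 0 ∧
      0 ≤ a 1 ∧
      0 ≤ a 2 ∧
      0 ≤ a 3 ∧
      0 ≤ a 4 ∧
      0 ≤ a 5 ∧
      0 ≤ a 6 ∧
      0 ≤ a 7 ∧
      0 ≤ -a 1 + a 5 + b ∧
      0 ≤ -a 3 + a 5 + a 6 ∧
      0 ≤ -a 3 + a 5 + b ∧
      0 ≤ -a 0 + a 2 + a 6 + a 7 - b := by
  unfold BrownConvergent twoOrd
  dsimp only [Nat.reduceAdd]
  simp only [forall_fin8, forall_fin5, Fin.sum_univ_eight]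
  simp [sameSide, p8_2, p8_2Den]
  constructor <;> intro h <;> and_intros <;> omega

/-! ### `₈π₃ = (8,2,5,1,7,3,6,4)` -/

/-- `₈π₃ = (8,2,5,1,7,3,6,4)` [Brown2016, App. 2 §10.1.4] as a map `Fin 8 → Fin 8` (0-based values). -/
def p8_3 : Fin 8 → Fin 8 := ![7, 1, 4, 0, 6, 2, 5, 3]

/-- `p8_3` is the printed plan `(8,2,5,1,7,3,6,4)` read 0-based (`ofSeating`), and is injective. -/
theorem p8_3_spec : p8_3 = ofSeating (ℓ := 5) [8, 2, 5, 1, 7, 3, 6, 4] ∧ Function.Injective p8_3 ∧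
    Brown2016.reps8[15]? = some [8, 2, 5, 1, 7, 3, 6, 4] := by
  refine ⟨by decide, by decide, rfl⟩

/-- Denominator exponents of the generalised `₈π₃` family, by position on `σδ⁰`
(`b(8,2), b(2,5), b(5,1), b(1,7), b(7,3), b(3,6), b(6,4), b(4,8)`), in the parameters
`a i = a_{i+1,i+2}` (`a : Fin 8 → ℤ`, 0-based; indices mod 8) and the free exponent `b = b(4,8)`, the others
solved from Brown's homogeneity equations [Brown2016, §5.1 (5.2), §5.2]. -/
def p8_3Den (a : Fin 8 → ℤ) (b : ℤ) : Fin 8 → ℤ :=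
  ![a 6 + a 7 - b, a 0 + a 1 - a 6 - a 7 + b, -a 0 - a 1 + a 3 + a 4 + a 6 + a 7 - b,
    2 * a 0 + a 1 - a 3 - a 4 - a 6 + b, -2 * a 0 - a 1 + a 3 + a 4 + a 5 + 2 * a 6 - b,
    2 * a 0 + 2 * a 1 + a 2 - a 3 - a 4 - a 5 - 2 * a 6 + b,
    -2 * a 0 - 2 * a 1 - a 2 + a 3 + 2 * a 4 + 2 * a 5 + 2 * a 6 - b, b]

/-- Homogeneity of the generalised `₈π₃` family holds exactly on Brown's lattice `H_σ` [Brown2016, §5.2 (5.5)]: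
`a 4 + a 5 + a 6 = a 0 + a 1 + a 2`. -/
theorem homogeneous_p8_3_iff (a : Fin 8 → ℤ) (b : ℤ) :
    Homogeneous p8_3 a (p8_3Den a b) ↔ a 4 + a 5 + a 6 = a 0 + a 1 + a 2 := by
  unfold Homogeneous
  dsimp only [Nat.reduceAdd]
  have e : (-1 : Fin 8) = 7 := by decide
  constructor
  · intro h
    have h' := h 7
    simp [p8_3, p8_3Den] at h'
    linarith
  · intro h i
    fin_cases i <;> simp [p8_3, p8_3Den, e] <;> linarith

/-- The region of convergence of the generalised `₈π₃` family on `H_σ`: Brown's chord condition (all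
`8 × 5` valuations; 20 distinct forms modulo `H_σ`, of which the 12 below are irredundant over `ℝ` —
exact LP, HOME `code/p2/cellular_atlas.py`; the equivalence itself is kernel-checked). [Brown2016, §2.4 (2.3), §5.2] -/
theorem brownConvergent_p8_3_iff (a : Fin 8 → ℤ) (b : ℤ) (hH : a 4 + a 5 + a 6 = a 0 + a 1 + a 2) :
    BrownConvergent p8_3 a (p8_3Den a b) ↔
      0 ≤ a 0 ∧
      0 ≤ a 1 ∧
      0 ≤ a 2 ∧
      0 ≤ a 3 ∧
      0 ≤ a 4 ∧
      0 ≤ a 5 ∧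
      0 ≤ a 6 ∧
      0 ≤ a 7 ∧
      0 ≤ a 0 - a 6 + b ∧
      0 ≤ a 2 + a 3 - a 5 ∧
      0 ≤ -a 2 + a 4 + b ∧
      0 ≤ -a 0 + a 2 + a 3 - a 5 + a 6 + a 7 - b := by
  unfold BrownConvergent twoOrd
  dsimp only [Nat.reduceAdd]
  simp only [forall_fin8, forall_fin5, Fin.sum_univ_eight]
  simp [sameSide, p8_3, p8_3Den]
  constructor <;> intro h <;> and_intros <;> omega

/-! ### `₈π₆ = (8,3,6,1,4,7,2,5)` -/

/-- `₈π₆ = (8,3,6,1,4,7,2,5)` [Brown2016, App. 2 §10.1.4] as a map `Fin 8 → Fin 8` (0-based values). -/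
def p8_6 : Fin 8 → Fin 8 := ![7, 2, 5, 0, 3, 6, 1, 4]

/-- `p8_6` is the printed plan `(8,3,6,1,4,7,2,5)` read 0-based (`ofSeating`), and is injective. -/
theorem p8_6_spec : p8_6 = ofSeating (ℓ := 5) [8, 3, 6, 1, 4, 7, 2, 5] ∧ Function.Injective p8_6 ∧
    Brown2016.reps8[16]? = some [8, 3, 6, 1, 4, 7, 2, 5] := by
  refine ⟨by decide, by decide, rfl⟩

/-- Denominator exponents of the generalised `₈π₆` family, by position on `σδ⁰`
(`b(8,3), b(3,6), b(6,1), b(1,4), b(4,7), b(7,2), b(2,5), b(5,8)`), in the parameters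
`a i = a_{i+1,i+2}` (`a : Fin 8 → ℤ`, 0-based; indices mod 8) and the free exponent `b = b(5,8)`, the others
solved from Brown's homogeneity equations [Brown2016, §5.1 (5.2), §5.2]. -/
def p8_6Den (a : Fin 8 → ℤ) (b : ℤ) : Fin 8 → ℤ :=
  ![a 6 + a 7 - b, a 1 + a 2 - a 6 - a 7 + b, -a 1 - a 2 + a 4 + a 5 + a 6 + a 7 - b,
    a 0 + a 1 + a 2 - a 4 - a 5 - a 6 + b, -a 0 - a 1 + a 3 + a 4 + a 5 + a 6 - b, a 0 + a 1 - a 3 - a 4 + b,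
    a 3 + a 4 - b, b]

/-- For `₈π₆` Brown's lattice condition (5.5) is EMPTY: the alternating sum vanishes identically, so the
generalised family is homogeneous for ALL `(a, b) ∈ ℤ^8 × ℤ` (9 free exponents). [Brown2016, §5.2 (5.5)] -/
theorem homogeneous_p8_6 (a : Fin 8 → ℤ) (b : ℤ) : Homogeneous p8_6 a (p8_6Den a b) := by
  have e : (-1 : Fin 8) = 7 := by decide
  intro i
  fin_cases i <;> simp [p8_6, p8_6Den, e] <;> ring

/-- The region of convergence of the generalised `₈π₆` family: Brown's chord condition (all
`8 × 5` valuations; 20 distinct forms modulo `H_σ`, of which the 12 below are irredundant over `ℝ` —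
exact LP, HOME `code/p2/cellular_atlas.py`; the equivalence itself is kernel-checked). [Brown2016, §2.4 (2.3), §5.2] -/
theorem brownConvergent_p8_6_iff (a : Fin 8 → ℤ) (b : ℤ) :
    BrownConvergent p8_6 a (p8_6Den a b) ↔
      0 ≤ a 0 ∧
      0 ≤ a 1 ∧
      0 ≤ a 2 ∧
      0 ≤ a 3 ∧
      0 ≤ a 4 ∧
      0 ≤ a 5 ∧
      0 ≤ a 6 ∧
      0 ≤ a 7 ∧
      0 ≤ a 0 + a 1 - a 6 + b + 1 ∧
      0 ≤ a 1 + a 2 - a 4 + b + 1 ∧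
      0 ≤ a 4 + a 5 + a 6 - b + 1 ∧
      0 ≤ -a 1 + a 3 + a 4 + a 6 + a 7 - b + 1 := by
  unfold BrownConvergent twoOrd
  dsimp only [Nat.reduceAdd]
  simp only [forall_fin8, forall_fin5, Fin.sum_univ_eight]
  simp [sameSide, p8_6, p8_6Den]
  constructor <;> intro h <;> and_intros <;> omega


end Summit.KontsevichZagierPeriods.Zeta5Search.Families.Cellular
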